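/-
Copyright (c) 2026 the pub-hodgecm-mathlib formalisation cell (harness21).  Prover seat hodgecm-mathlib-K2Liu-p02 (g7), Track B «K2-LIT» ∕ hLiu418
#184♮, socket #41 open surface (u-0c) `K2LiuSiegelEisensteinMiddleTermPackageInstance` (LEAD F0P6-plan (g14) BATCH #49 (4)); census finding:
★ (β0-4) `exists_middle_package_of_faces` carries an UNSATISFIABLE growth binder `hEg` — this file DISCHARGES it by ★ (δ).  THEOREMS ONLY (no `def`, no
`instance`, no notation, no named-fact hypothesis, no `sorry`).
-/
import Summits.HodgeConjecture.HodgeConjecture.Theorems.K2LiuMiddleCellPackageOfFaces          -- ★ (β0-4) `exists_middle_finite_sum` (+ ★ (γ) `exists_middle_package`)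
import Summits.HodgeConjecture.HodgeConjecture.Theorems.K2LiuMirabolicEisensteinModerateGrowth   -- ★ (δ) `tateNumeratorGL_moderateGrowth_locally_uniform_family`
import HarnessLib

/-!
# Crux `HLiu418`, Road Φ, organ G5-a, face (β0-4)′: THE MIDDLE CELL PACKAGE FROM ITS FACES — WITH THE `E⋆`-GROWTH BINDER DISCHARGED

Cell `hodgecm-mathlib`, crux item hLiu418 = `stmt-HodgeConjecture-24832`; squad K2 ∕ K2Liu, prover K2Liu-p02 (g7); lane `--supports stmt-HodgeConjecture-24832 --as helper`,
count-neutral.  Namespace `Summit.HodgeConjecture.HodgeConjecture.Cruxes.HLiu418.K2LiuMiddleCellPackageOfFacesGrowth`.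

THE FINDING ((u-0c) census, K2Liu-p02 (g7)).  ★ (β0-4) `K2LiuMiddleCellPackageOfFaces.exists_middle_package_of_faces` takes the growth of the continued mirabolic
series BY VALUE in the shape `hEg : ∀ z′, ½ < re z′ → ∃ C A r, … ∀ s′, dist s′ z′ < r → ∀ Ψ ∈ 𝒮(𝔸_L²), ∀ gg, ‖E⋆(Ψ, s′, gg)‖ ≤ C · ‖gg‖^A` — ONE constant `C` BEFORE
the Schwartz datum `Ψ`.  Since `Ψ ↦ E⋆(Ψ, s′, gg)` is homogeneous (`E⋆(λΨ) = λ·E⋆(Ψ)`) and `𝒮` is a vector space, such a bound forces `E⋆(Ψ, s′, gg) = 0` for every `Ψ`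
on the ball, hence (entire in `s′`, ★ `differentiable_tateNumeratorGL`) everywhere, contradicting ★ `tateNumeratorGL_zero` (`E⋆(Ψ, 0, g) = V·Ψ(0)∕n ≠ 0` for `Ψ(0) ≠ 0`):
the binder is UNSATISFIABLE, so no instance can pass through ★ (β0-4) §3 as stated.  The proof of ★ (β0-4) uses `hEg` ONLY at the FINITE family `Φ j` produced by
★ §2 `exists_middle_finite_sum` — and for a finite family the bound is ★ (δ) `K2LiuMirabolicEisensteinModerateGrowth.tateNumeratorGL_moderateGrowth_locally_uniform_family`
(K2Liu-p10 lineage), hypothesis-free modulo the idele class domain.  THIS FILE re-assembles ★ §2 + ★ (γ) with ★ (δ) in place of `hEg`: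
**`exists_middle_package_of_faces'`** — ★ (β0-4) §3's statement with the `hEg` binder REMOVED (all other binders byte-identical), clause (iv) read as
`E₇ s x = (s − ½) · MID s x` and the growth constant recorded non-negative.  This is the head (u-0c)
`K2LiuSiegelEisensteinMiddleTermPackageInstance` instantiates at the curve frame.
[MoeglinWaldspurger1995, II.1.7, IV.1.9; CogdellAnalyticTheory2004, §2.3 Thm. 2.2; Tan1999, §4 Prop. 4.8.]

HONEST LABEL.  Count-neutral helper: `HC_CM` is proved only modulo the 7 printed citations (2 remaining named inputs: hLiu418 = `stmt-HodgeConjecture-24832`,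
h413 = `stmt-HodgeConjecture-24833`) until rung 0 closes; closes no socket by itself.
-/

set_option autoImplicit false
set_option linter.dupNamespace false -- the mandated namespace repeats `HodgeConjecture.HodgeConjecture`

noncomputable section

open MeasureTheory Measure NumberField NumberField.mixedEmbedding IsDedekindDomain Set Filter Topology Metric
open scoped NNReal Matrix BigOperators
open Literature.NumberTheory.Automorphic
open Literature.NumberTheory.GaloisRepresentations (ideleGroup)
open Summit.HodgeConjecture.HodgeConjecture.Cruxes.HLiu418.K2LiuGL2FlatSectionFiniteData (ofFinite_mem)
open Summit.HodgeConjecture.HodgeConjecture.Cruxes.HLiu418.K2LiuMiddleCellPackageOfFaces (exists_middle_finite_sum)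
open Summit.HodgeConjecture.HodgeConjecture.Cruxes.HLiu418.K2LiuSiegelEisensteinRankZeroTermPackage (exists_middle_package)
open Summit.HodgeConjecture.HodgeConjecture.Cruxes.HLiu418.K2LiuMirabolicEisensteinModerateGrowth (tateNumeratorGL_moderateGrowth_locally_uniform_family)

namespace Summit.HodgeConjecture.HodgeConjecture.Cruxes.HLiu418.K2LiuMiddleCellPackageOfFacesGrowth

variable {L : Type} [Field L] [NumberField L]

variable [IsTotallyComplex L] [MeasurableSpace (AdeleRing (𝓞 L) L)] [BorelSpace (AdeleRing (𝓞 L) L)]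
  (ν : Measure (ideleGroup L)) [ν.IsHaarMeasure] (μ : Measure (Fin 2 → AdeleRing (𝓞 L) L)) [μ.IsAddHaarMeasure]
  (μinf : Measure (mixedSpace L)ˣ) [μinf.IsHaarMeasure]
  (S : Finset (HeightOneSpectrum (𝓞 L))) (γl : ∀ v : HeightOneSpectrum (𝓞 L), ValuativeRel.ValueGroupWithZero (v.adicCompletion L))
  (hγ0 : ∀ v ∈ S, γl v ≠ 0) (hγ1 : ∀ v ∈ S, γl v < 1)
  {X : Type*} [TopologicalSpace X] [FirstCountableTopology X]
  (height : X → ℝ) (hpos : ∀ x, 0 < height x) (hcpt : ∀ K : Set X, IsCompact K → ∃ Bd : ℝ, ∀ x ∈ K, height x ≤ Bd)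
  (W : Submodule ℂ (↥(standardMaximalCompactGL 2 L) → ℂ)) [FiniteDimensional ℂ W]
  (hWstab : ∀ B ∈ W, ∀ k₀ : ↥(standardMaximalCompactGL 2 L), (fun k => B (k * k₀)) ∈ W)
  (hWlaw : ∀ B ∈ W, ∀ p k : ↥(standardMaximalCompactGL 2 L),
    ((p : GL (Fin 2) (AdeleRing (𝓞 L) L)) : Matrix (Fin 2) (Fin 2) (AdeleRing (𝓞 L) L)) 1 0 = 0 → B (p * k) = B k)
  (hWlev : ∀ B ∈ W, ∀ (k : ↥(standardMaximalCompactGL 2 L)) (r : GL (Fin 2) (FiniteAdeleRing (𝓞 L) L)) (hr : r ∈ glFiniteIntegralLevel 2 L),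
    (∀ v ∈ S, GLn.evalAt 2 L v r ∈ congruenceGL 2 (γl v)) →
      B ⟨(k : GL (Fin 2) (AdeleRing (𝓞 L) L)) * GLn.ofFinite 2 L r, (standardMaximalCompactGL 2 L).mul_mem k.2 (ofFinite_mem hr)⟩ = B k)
  (hWcont : ∀ B ∈ W, Continuous B)
  (hWext : ∀ B ∈ W, ∃ bB : ℂ → GL (Fin 2) (AdeleRing (𝓞 L) L) → ℂ,
    (∀ s : ℂ, 0 < s.re → ∀ (d : Fin 2 → (AdeleRing (𝓞 L) L)ˣ) (g : GL (Fin 2) (AdeleRing (𝓞 L) L)),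
      bB s (glDiagonal 2 (AdeleRing (𝓞 L) L) d * g) =
        ((IdeleClassGroup.ideleNorm L (d 0) : ℝ) : ℂ) ^ (s + 1 / 2) * ((IdeleClassGroup.ideleNorm L (d 1) : ℝ) : ℂ) ^ (-(s + 1 / 2)) * bB s g) ∧
    (∀ s : ℂ, 0 < s.re → ∀ u g : GL (Fin 2) (AdeleRing (𝓞 L) L), (u : Matrix (Fin 2) (Fin 2) (AdeleRing (𝓞 L) L)) 1 0 = 0 →
      (u : Matrix (Fin 2) (Fin 2) (AdeleRing (𝓞 L) L)) 0 0 = 1 → (u : Matrix (Fin 2) (Fin 2) (AdeleRing (𝓞 L) L)) 1 1 = 1 → bB s (u * g) = bB s g) ∧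
    (∀ s : ℂ, 0 < s.re → ∀ (k : GL (Fin 2) (AdeleRing (𝓞 L) L)) (hk : k ∈ standardMaximalCompactGL 2 L), bB s k = B ⟨k, hk⟩))
  (φ : ℂ → X → GL (Fin 2) (AdeleRing (𝓞 L) L) → ℂ)
  (hφT : ∀ (s : ℂ) (x : X), 0 < s.re → ∀ (d : Fin 2 → (AdeleRing (𝓞 L) L)ˣ) (g : GL (Fin 2) (AdeleRing (𝓞 L) L)),
    φ s x (glDiagonal 2 (AdeleRing (𝓞 L) L) d * g) =
      ((IdeleClassGroup.ideleNorm L (d 0) : ℝ) : ℂ) ^ (s + 1 / 2) * ((IdeleClassGroup.ideleNorm L (d 1) : ℝ) : ℂ) ^ (-(s + 1 / 2)) * φ s x g)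
  (hφN : ∀ (s : ℂ) (x : X), 0 < s.re → ∀ u g : GL (Fin 2) (AdeleRing (𝓞 L) L), (u : Matrix (Fin 2) (Fin 2) (AdeleRing (𝓞 L) L)) 1 0 = 0 →
    (u : Matrix (Fin 2) (Fin 2) (AdeleRing (𝓞 L) L)) 0 0 = 1 → (u : Matrix (Fin 2) (Fin 2) (AdeleRing (𝓞 L) L)) 1 1 = 1 → φ s x (u * g) = φ s x g)
  (hφW : ∀ (s : ℂ) (x : X), 0 < s.re → (fun k : ↥(standardMaximalCompactGL 2 L) => φ s x k) ∈ W)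
  (hφhol : ∀ (x : X) (k : ↥(standardMaximalCompactGL 2 L)), DifferentiableOn ℂ (fun s => φ s x k) {s : ℂ | 0 < s.re})
  (hφbd : ∀ z : ℂ, 0 < z.re → ∃ C A r : ℝ, 0 ≤ C ∧ 0 ≤ A ∧ 0 < r ∧ ∀ s : ℂ, dist s z < r →
    ∀ (x : X) (k : ↥(standardMaximalCompactGL 2 L)), ‖φ s x k‖ ≤ C * height x ^ A)
  (mx : X → GL (Fin 2) (AdeleRing (𝓞 L) L)) {C₀ A₀ : ℝ} (hC₀ : 0 ≤ C₀) (hA₀ : 0 ≤ A₀)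
  (hmx : ∀ x, adelicHeightGL 2 L (mx x) ≤ C₀ * height x ^ A₀)
  (γ : Projectivization L (Fin 2 → L) → GL (Fin 2) L)
  (hγ : ∀ p, ∃ cL : L, cL ≠ 0 ∧ (Pi.single 1 1 : Fin 2 → L) ᵥ* (γ p : Matrix (Fin 2) (Fin 2) L) = cL • p.rep)
  {𝓕 : Set (ideleGroup L)} (h𝓕 : IsIdeleClassDomain L 𝓕)
  (hHpos : ∀ gg : GL (Fin 2) (AdeleRing (𝓞 L) L), 0 < adelicHeightGL 2 L gg)
  {c : ℝ} (hc : 1 / 2 ≤ c) (c₀ : ℂ) (MID : ℂ → X → ℂ) (hMIDc : ∀ s : ℂ, c < s.re → Continuous (MID s))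
  (hMID : ∀ (s : ℂ) (x : X), c < s.re → MID s x = c₀ * ∑' p : Projectivization L (Fin 2 → L),
    φ s x (Matrix.GeneralLinearGroup.map (algebraMap L (AdeleRing (𝓞 L) L)) (γ p) * mx x))


include ν μ hγ0 hγ1 hpos hcpt hWstab hWlaw hWlev hWcont hWext hφT hφN hφW hφhol hφbd hC₀ hA₀ hmx hγ h𝓕 hHpos hc hMIDc hMID μinf in
/-- **(β0-4)′ THE `(P, E⋆)`-PACKAGE OF THE MIDDLE CELL FROM ITS FACES, `E⋆`-GROWTH DISCHARGED** — ★ `exists_middle_package_of_faces` with its (unsatisfiable, uniform-in-`Ψ`)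
binder `hEg` REMOVED: the growth of `E⋆` on the finite Godement family of ★ `exists_middle_finite_sum` is ★ (δ) `tateNumeratorGL_moderateGrowth_locally_uniform_family`.
Remaining binders by value, byte-identical to ★ (β0-4) §3: the idele class domain, the height comparison of the Iwasawa coordinate `m x`, `hHpos`, the continuity of
`MID(s, ·)`, the `W`-package, the untwisted inner family `φ` and its laws, the coset section `γ`, `hMID`.
[cite: MoeglinWaldspurger1995, II.1.7, IV.1.9] [cite: CogdellAnalyticTheory2004, §2.3 Thm. 2.2] [cite: Tan1999, §4 Prop. 4.8] -/
theorem exists_middle_package_of_faces' :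
    ∃ E₇ : ℂ → X → ℂ,
      (∀ x, DifferentiableOn ℂ (fun s => E₇ s x) {s : ℂ | 0 < s.re}) ∧
      (∀ s : ℂ, 0 < s.re → Continuous (E₇ s)) ∧
      (∀ (s : ℂ) (x : X), c < s.re → E₇ s x = (s - 1 / 2) * MID s x) ∧
      (∀ z : ℂ, 0 < z.re → ∃ C A r : ℝ, 0 ≤ C ∧ 0 < r ∧ ∀ s : ℂ, dist s z < r → ∀ x, ‖E₇ s x‖ ≤ C * height x ^ A) := by
  obtain ⟨ι, instι, a, Φ, hΦ, had, hag, hsum⟩ := exists_middle_finite_sum ν μinf S γl hγ0 hγ1 height hpos W hWstab hWlaw hWlev hWcont hWext φ hφT hφN hφW hφhol hφbd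
    mx γ hγ hc c₀ MID hMID
  obtain ⟨E₇, hd, hcont, heq, hgr⟩ := exists_middle_package ν μ (by norm_num : 0 < 2) h𝓕 height hpos hcpt Φ hΦ (fun _ => mx) hC₀ hA₀ (fun _ x => hmx x)
    a had hag (tateNumeratorGL_moderateGrowth_locally_uniform_family ν μ (by norm_num : 0 < 2) h𝓕 Φ hΦ) hHpos hc MID hMIDc hsum
  refine ⟨E₇, hd, hcont, fun s x hs => ?_, fun z hz => ?_⟩
  · -- `∏_{p ∈ {½}} (s − p) = s − ½`
    rw [heq s x hs, Finset.prod_singleton]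
  · -- a non-negative constant: `C ↦ max C 0`
    obtain ⟨C, A, r, hr, hle⟩ := hgr z hz
    refine ⟨max C 0, A, r, le_max_right _ _, hr, fun s hs x => (hle s hs x).trans ?_⟩
    exact mul_le_mul_of_nonneg_right (le_max_left _ _) (Real.rpow_nonneg (hpos x).le _)

end Summit.HodgeConjecture.HodgeConjecture.Cruxes.HLiu418.K2LiuMiddleCellPackageOfFacesGrowth

end
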